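import Summits.QuantumFields.YangMills.Theses.SteinGapBootstrap
import Summits.QuantumFields.YangMills.Theorems.SteinGapBootstrapFreeProbeLawGStubBudgetRate
import Summits.QuantumFields.YangMills.Theorems.SteinGapBootstrapFreeProbeLawGStubFieldBounds
import Summits.QuantumFields.YangMills.Theorems.SteinGapBootstrapFreeProbeLawGStubSdRate
import Summits.QuantumFields.YangMills.Theorems.SteinGapBootstrapFreeProbeLawGStubBlockGreen
import Summits.QuantumFields.YangMills.Theorems.SteinGapBootstrapFreeProbeLawGAssemblyFinal
import Summits.QuantumFields.YangMills.Theorems.SteinGapBootstrapFreeProbeLawGOfSteinSplit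
import Summits.QuantumFields.YangMills.Theorems.SteinGapBootstrapUSteinTransferPair
import Summits.QuantumFields.YangMills.Theorems.SteinGapBootstrapProbeCovFromPairLawG

/-! # Crux U = `Theses.SteinGapBootstrap.FreeProbeLawG` (stmt-QuantumFields-23756) — PROVED (line `birth`, Stein's seam)

Lead `ym-line-sgb-k1-g1` (2026-08-28). RESHAPE 2 of the planner's birth skeleton (ym-idea-4 g2): the XL child C1ᶠ `PairSteinDiscrepancyFreeG`
(stmt-23798) is cut along the mechanism «closedness + block Green truncation + finite-β Schwinger–Dyson + energy budget» (NOTES.md §Mechanism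
of the lead; no clustering, no conditional expectations):

* `stub_budgetRate` (M, LANDED p590174; imported): sharp equipartition at rate per plaquette for every torus-limit state, from the CLOSED
  `EntropyBudgetEquipartition.FreeEnergyRate` + `budgetRate_limitStates` + axis/orientation symmetry + B-TI.
* `stub_sdRate` (L): the tree's finite-β single-edge Schwinger–Dyson identity (TS5–TS7 of `EquipartitionPinsProbe`, `core_defect`,
  `defect_le`, `stub_haarShiftLimit`) generalised from trigonometric functions of ONE linear statistic to bounded `C¹` test functions
  `g(Y_S)` of the block field, WITH EXPLICIT RATE: `|E_μ[∂_v g(Y_S)] − E_μ[g(Y_S)·(d^*Y)_e^b]| ≤ C(1+M)(1+ρS)^c β^(−κ)`, `v = dδ_e ⊗ e_b`,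
  for limit states with plaquette energies `≤ E₀/β` (comb Poincaré `stub_combPoincare` gives the comb-link energies; `θ = β^(−1/2)`).
* `stub_blockGreen` (L, pure lattice analysis, no gauge theory): the truncated Green `1`-form `ω = 1_(box R) · Γ d^*δ_p`
  (`ω(e) = Σ_a σ_a edgeGreen (∂_a p) e`): supported in the box, `ℓ¹`-norm `≤ C(1+R)^c`, `dω = curvatureTwoPoint p ·` EXACTLY on plaquettes
  well inside, and `|‖dω‖² − curvatureTwoPoint p p| ≤ C(1+R)^(−γ)` (tail/boundary layer from `latticeGreen_asymptotics`: `|ω(e)| ≲ |e|^(−3)`,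
  `Σ_q Π(p,q)² = Π(p,p)`).
* `stub_fieldBounds` (M, LANDED p591633 by w3-g2; imported): (a) pointwise `Σ_a (Y_p^a)² ≤ 2β·cost_p` for the `(1,2)`-plaquettes on the `e₀` axis (comb gauge: one live link,
  Bessel for the orthonormal Lie frame, `‖V − 1‖²_HS = 2(N − Re tr V)`); (b) crude polynomial second moments `E_μ (Y_p^a)² ≤ C(1+|p|)^c` under
  plaquette energies `≤ E₀/β` (comb Poincaré).
* `stub_assembly` (L, the lead's): (sdRate) → (blockGreen) → (fieldBounds) → [budget ⇒ C1ᶠ-conclusion]: Green resummation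
  `E[⟨dω,Y⟩∂F] = Σ_e ω(e)·SD_e`, exact closedness of `Y = d(linkField)`, and the BACKGROUND LEMMA — the energy budget bounds
  `E|Y_p − ⟨dω,Y⟩|` through the characteristic-function ODE `φ_(Y_p)(t) = e^(−t²s/2) φ_X(t) + err` (trigonometric SD) and Gaussian deconvolution.
* `stub_steinTransfer : USteinTransferPair` (23799, CLOSED by `USteinTransferPair_proof`, w2) and `stub_probeFromPairLaw :
  UProbeCovFromPairLaw` (23800, CLOSED by `uProbeCovFromPairLaw_proof`, w3) are now one-line citations.
ALL STUBS LANDED: stub_sdRate p593143 (w2-g3), stub_blockGreen p592741 (w3-g2), stub_assembly (lead; Theorems/…AssemblyFinal with helpers A1 SteinPair, A2c Resum,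
A3a AssemblyCore, A3b AssemblyGen, A3c AssemblyPair, A2a TestFun (w3-g2), A3d AssemblyBackground/AssemblyMain, A3e AssemblyMono). This file is sorry-free and
closes the crux BY NAME (`FreeProbeLawG_holds`, alias `Theorems.SteinGapBootstrap.freeProbeLawG_proof`).
Compositions `stub_pairSteinOfBudget'` (assembly of the three inputs), `pairSteinDiscrepancyFreeG_of_budget` (⇒ C1ᶠ) and `FreeProbeLawG_of`
(⇒ the crux BY NAME; = CLOSED glue 23801) are kernel-checked below. Stub signatures avoid `let`/`letI` binders (gate registrar).
HONEST LABEL: the route closes the RECORD rung R2ξ-G (`WeakCouplingRates.XiPow`, an upper bound on the lattice gap) conditionally on U;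
nothing here proves the Yang–Mills mass gap. -/

open MeasureTheory

namespace Summit.QuantumFields.YangMills.Cruxes.FreeProbeLawG.SteinFree

open Summit.QuantumFields.YangMills.Theses.SteinGapBootstrap

/-- stub `stub_steinTransfer` — CLOSED: item 23799 proved by `USteinTransferPair_proof` (width seat w2-g2). -/
theorem stub_steinTransfer : USteinTransferPair :=
  Summit.QuantumFields.YangMills.Theorems.SteinGapBootstrap.USteinTransferPair_proof

/-- stub `stub_probeFromPairLaw` — CLOSED: item 23800 proved by `uProbeCovFromPairLaw_proof` (width seat w3-g2). -/
theorem stub_probeFromPairLaw : UProbeCovFromPairLaw :=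
  Summit.QuantumFields.YangMills.Theorems.SteinGapBootstrap.uProbeCovFromPairLaw_proof

/-- composition 0 (kernel-checked): the wall «Stein discrepancy from the budget» from the three inputs and the assembly. -/
theorem stub_pairSteinOfBudget' :
    ∀ (G : Type) [Group G] [TopologicalSpace G] [IsTopologicalGroup G] [CompactSpace G]
      [MeasurableSpace G] [BorelSpace G],
      Literature.MathematicalPhysics.QuantumFieldTheory.IsCompactSimpleLieGroup G →
      ∀ r : Literature.MathematicalPhysics.QuantumFieldTheory.LatticeRep G,
        ∀ κ Cb : ℝ, 0 < κ →
        ∃ (K δ C β₀ : ℝ), 0 < δ ∧ 0 < C ∧ ∀ β : ℝ, β₀ ≤ β →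
          ∀ μ ∈ Literature.MathematicalPhysics.QuantumLattice.infiniteVolumeLimitPoints (d := 4) r.ρ β,
            (∀ (x : Literature.Probability.LatticeModels.Site 4) (i j : Fin 4), i ≠ j →
              |β * (∫ U, ((r.N : ℝ) - Literature.MathematicalPhysics.QuantumLattice.plaquetteObs r.ρ x i j U) ∂μ) -
                  (Summit.QuantumFields.YangMills.Theorems.EquipartitionPinsProbe.lieDim r : ℝ) / 4| ≤ Cb * β ^ (-κ)) →
            ∀ n : ℕ, 1 ≤ n → ∀ B : Finset (Literature.MathematicalPhysics.QuantumLattice.ZdPlaquette 4),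
              B = {Literature.MathematicalPhysics.QuantumFieldTheory.plaquette12 (d := 4) (by norm_num) 0,
                    Literature.MathematicalPhysics.QuantumFieldTheory.plaquette12 (d := 4) (by norm_num) (Pi.single (0 : Fin 4) (n : ℤ))} →
              ∀ (F : (↥B → Fin (Summit.QuantumFields.YangMills.Theorems.EquipartitionPinsProbe.lieDim r) → ℝ) → ℝ) (M : ℝ),
                0 ≤ M → ContDiff ℝ 2 F → (∀ x, ‖fderiv ℝ F x‖ ≤ 1) → (∀ x y, ‖fderiv ℝ F x - fderiv ℝ F y‖ ≤ M * ‖x - y‖) →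
                |∫ U, Literature.MathematicalPhysics.QuantumFieldTheory.latticeMaxwellBlockGenerator B
                    (Summit.QuantumFields.YangMills.Theorems.EquipartitionPinsProbe.lieDim r) F
                    (fun p a => Summit.QuantumFields.YangMills.Theorems.EquipartitionPinsProbe.plaqField r β U
                      (p : Literature.MathematicalPhysics.QuantumLattice.ZdPlaquette 4) a) ∂μ| ≤
                  C * (1 + (n : ℝ)) ^ K * β ^ (-δ) * (1 + M) :=
  fun G _ _ _ _ _ _ hG r => stub_assembly G hG r (stub_sdRate G hG r) stub_blockGreen (stub_fieldBounds G hG r)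

/-- composition 1 (kernel-checked): budget rate + Stein-from-budget ⇒ C1ᶠ `PairSteinDiscrepancyFreeG` (the equipartition hypothesis (i)
of C1ᶠ is not needed: the budget stub supplies the sharp version for every limit state). -/
theorem pairSteinDiscrepancyFreeG_of_budget
    (hB : ∀ (G : Type) [Group G] [TopologicalSpace G] [IsTopologicalGroup G] [CompactSpace G]
        [MeasurableSpace G] [BorelSpace G],
        Literature.MathematicalPhysics.QuantumFieldTheory.IsCompactSimpleLieGroup G →
        ∀ r : Literature.MathematicalPhysics.QuantumFieldTheory.LatticeRep G,
        ∃ κ C β₀ : ℝ, 0 < κ ∧ ∀ β : ℝ, β₀ ≤ β →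
          ∀ μ ∈ Literature.MathematicalPhysics.QuantumLattice.infiniteVolumeLimitPoints (d := 4) r.ρ β,
            ∀ (x : Literature.Probability.LatticeModels.Site 4) (i j : Fin 4), i ≠ j →
              |β * (∫ U, ((r.N : ℝ) - Literature.MathematicalPhysics.QuantumLattice.plaquetteObs r.ρ x i j U) ∂μ) -
                  (Summit.QuantumFields.YangMills.Theorems.EquipartitionPinsProbe.lieDim r : ℝ) / 4| ≤ C * β ^ (-κ))
    (hS : ∀ (G : Type) [Group G] [TopologicalSpace G] [IsTopologicalGroup G] [CompactSpace G]
        [MeasurableSpace G] [BorelSpace G],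
        Literature.MathematicalPhysics.QuantumFieldTheory.IsCompactSimpleLieGroup G →
        ∀ r : Literature.MathematicalPhysics.QuantumFieldTheory.LatticeRep G,
        ∀ κ Cb : ℝ, 0 < κ →
        ∃ (K δ C β₀ : ℝ), 0 < δ ∧ 0 < C ∧ ∀ β : ℝ, β₀ ≤ β →
          ∀ μ ∈ Literature.MathematicalPhysics.QuantumLattice.infiniteVolumeLimitPoints (d := 4) r.ρ β,
            (∀ (x : Literature.Probability.LatticeModels.Site 4) (i j : Fin 4), i ≠ j →
              |β * (∫ U, ((r.N : ℝ) - Literature.MathematicalPhysics.QuantumLattice.plaquetteObs r.ρ x i j U) ∂μ) -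
                  (Summit.QuantumFields.YangMills.Theorems.EquipartitionPinsProbe.lieDim r : ℝ) / 4| ≤ Cb * β ^ (-κ)) →
            ∀ n : ℕ, 1 ≤ n → ∀ B : Finset (Literature.MathematicalPhysics.QuantumLattice.ZdPlaquette 4),
              B = {Literature.MathematicalPhysics.QuantumFieldTheory.plaquette12 (d := 4) (by norm_num) 0,
                    Literature.MathematicalPhysics.QuantumFieldTheory.plaquette12 (d := 4) (by norm_num) (Pi.single (0 : Fin 4) (n : ℤ))} →
              ∀ (F : (↥B → Fin (Summit.QuantumFields.YangMills.Theorems.EquipartitionPinsProbe.lieDim r) → ℝ) → ℝ) (M : ℝ),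
                0 ≤ M → ContDiff ℝ 2 F → (∀ x, ‖fderiv ℝ F x‖ ≤ 1) → (∀ x y, ‖fderiv ℝ F x - fderiv ℝ F y‖ ≤ M * ‖x - y‖) →
                |∫ U, Literature.MathematicalPhysics.QuantumFieldTheory.latticeMaxwellBlockGenerator B
                    (Summit.QuantumFields.YangMills.Theorems.EquipartitionPinsProbe.lieDim r) F
                    (fun p a => Summit.QuantumFields.YangMills.Theorems.EquipartitionPinsProbe.plaqField r β U
                      (p : Literature.MathematicalPhysics.QuantumLattice.ZdPlaquette 4) a) ∂μ| ≤
                  C * (1 + (n : ℝ)) ^ K * β ^ (-δ) * (1 + M)) :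
    PairSteinDiscrepancyFreeG := by
  intro G _ _ _ _ hG
  letI : MeasurableSpace G := borel G
  haveI : BorelSpace G := ⟨rfl⟩
  intro r C₀
  obtain ⟨κ, Cb, β₁, hκ, HB⟩ := hB G hG r
  obtain ⟨K, δ, C, β₀, hδ, hC, HS⟩ := hS G hG r κ Cb hκ
  refine ⟨K, δ, C, max β₀ β₁, hδ, hC, ?_⟩
  intro β hβ μ hμ _hi n hn B YB F M hM hF hF1 hF2
  exact HS β (le_trans (le_max_left _ _) hβ) μ hμ (HB β (le_trans (le_max_right _ _) hβ) μ hμ) n hn B rfl F M hM hF hF1 hF2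

/-- C1ᶠ from the stubs. -/
theorem stub_pairSteinFree' : PairSteinDiscrepancyFreeG :=
  pairSteinDiscrepancyFreeG_of_budget stub_budgetRate stub_pairSteinOfBudget'

/-- composition 2 (kernel-checked): the four stubs give the crux BY NAME (aliases unfold by defeq). -/
theorem FreeProbeLawG_of :
    PairSteinDiscrepancyFreeG → USteinTransferPair → UProbeCovFromPairLaw →
      Summit.QuantumFields.YangMills.Theses.SteinGapBootstrap.FreeProbeLawG :=
  Summit.QuantumFields.YangMills.Theorems.SteinGapBootstrap.freeProbeLawG_of_steinSplit_proof

/-- **Crux U `FreeProbeLawG` holds** (all four stubs of line `birth` landed). HONEST LABEL: this closes the RECORD rung R2ξ-G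
(`WeakCouplingRates.XiPow`) through the route's CLOSED `AssemblyR`; it is NOT the Yang–Mills mass gap. -/
theorem FreeProbeLawG_holds : Summit.QuantumFields.YangMills.Theses.SteinGapBootstrap.FreeProbeLawG :=
  FreeProbeLawG_of stub_pairSteinFree' stub_steinTransfer stub_probeFromPairLaw

end Summit.QuantumFields.YangMills.Cruxes.FreeProbeLawG.SteinFree

namespace Summit.QuantumFields.YangMills.Theorems.SteinGapBootstrap

/-- **Item stmt-QuantumFields-23756, crux U `FreeProbeLawG` of route `SteinGapBootstrap`, BY NAME**: the unconditional rate-form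
free-gluon probe law for every compact simple `G` — for every equipartitioned, axis-symmetric torus-limit state of the 4-D Wilson theory at
`β ≥ β₀` and every separation `n ≥ 1`, the time-covariance of the probe `exp(−2(β(N − Re tr r(U_p)))₊)` is within `C(1+n)^K β^(−δ)` of the
free-gluon profile `2^(−D)((1 − c_n²)^(−D/2) − 1)`. Proof = line `birth`: sharp budget from the free-energy rate, finite-β Schwinger–Dyson
identities resummed against truncated Green `1`-forms, the Stein pair of the block plaquette field, Stein's lemma for the lattice-Maxwell
block law, and the probe step. NOT THE CLAY GAP (RECORD rung R2ξ-G). -/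
theorem freeProbeLawG_proof : Summit.QuantumFields.YangMills.Theses.SteinGapBootstrap.FreeProbeLawG :=
  Summit.QuantumFields.YangMills.Cruxes.FreeProbeLawG.SteinFree.FreeProbeLawG_holds

end Summit.QuantumFields.YangMills.Theorems.SteinGapBootstrap
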